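import Summits.QuantumFields.YangMills.Theorems.LuscherReductionTwistedTraceScalingBTProfileRecord
import Summits.QuantumFields.YangMills.Theorems.LuscherReductionTwistedTraceScalingStiffHessian
import Mathlib.LinearAlgebra.Lagrange
import Mathlib.LinearAlgebra.Eigenspace.Minpoly
import HarnessLib

/-!
# THE FROZEN STIFF GAUSSIAN PROFILE: `q_{t,b}(x) = Σᵢ cᵢ⟪eᵢ,x⟫²` is measurable, nonnegative and COLOUR BLIND; (B-ST)+(B-OD) against it give the record analytic input
# (lane A of S-BASE, crux `TwistedTraceScaling` stmt-QuantumFields-20203, C4-CORE; design note `pub/ym-fleet/ym-luscher-20007-p1/COARSE-DESIGN.md` §26.4)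

The profile that (B-ST)/(B-OD) need is the ground state of the harmonic stiff transfer kernel `e^{−⟪x,tHx⟫}e^{−b‖x−y‖²}e^{−⟪y,tHy⟫}` (`H = d†d` the stiff Hessian,
`…StiffHessian.stiff_groundState`): `h(x) = e^{−q(x)}`, `q(x) = Σᵢ cᵢ⟪eᵢ,x⟫²`, `(eᵢ,aᵢ)` the eigenframe of `tH`, `cᵢ = √(aᵢ² + 2aᵢb)`.
* §1 ★ `sum_eigen_sq_isometry_invariant` — linear algebra: for a symmetric `T` on a finite-dimensional real inner product space, ANY `g : ℝ → ℝ`, and a linear isometry `R`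
  commuting with `T`: `Σᵢ g(aᵢ)⟪eᵢ,Rx⟫² = Σᵢ g(aᵢ)⟪eᵢ,x⟫²` (Lagrange interpolation of `g` on the spectrum turns the sum into `⟪x, p(T)x⟫`).
* §2 colour equivariance of the stiff Hessian: `latCurl_adL`, `norm_latCurl_adL`, `inner_latCurl_adL`, ★ `stiffHessian_adL` (`H(Ad_g x) = Ad_g(Hx)`).
* §3 `stiffGaussExp L t b` (the one definition of this file), `stiffGaussExp_nonneg`, `continuous_stiffGaussExp`, `measurable_stiffGaussExp`, ★ `stiffGaussExp_adL`.
* §4 ★★★ `recordAnalyticInput_of_stiffGauss` — (B-ST) + (B-OD) against `Ω = frozenProfile L (fun β => stiffGaussExp L (t β) (b β)) r_B` (`r_B = min(1/40, β^{-1/2}ℓ)`, any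
  schedules `t, b : ℝ → ℝ`) ⇒ `Nonempty (RecordAnalyticInput L s M)` (`1/6 < s ≤ 1/4`), by `…BTProfileRecord.recordAnalyticInput_of_frozenProfile`.
* §5 ★ `stiff_groundState_stiffGaussExp` — `Stiff.stiff_groundState` restated for `h = e^{−stiffGaussExp L t b}` (`t ≥ 0`, `b > 0`).
HONEST FRAMING: the normalisation `(t, b)` of the fibre kernel is left to the (B-ST)/(B-OD) pens; (B-ST), (B-OD) OPEN; C4-CORE OPEN; stub of a child of the CONDITIONAL route R2b1;
not infinite volume, not a gap, not Clay.
-/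

set_option autoImplicit false

noncomputable section

open MeasureTheory Filter Topology Real Polynomial
open scoped BigOperators RealInnerProductSpace
open Literature.MathematicalPhysics.QuantumFieldTheory
open Literature.MathematicalPhysics.QuantumLattice

namespace Summit.QuantumFields.YangMills.Theorems.FemtoTransferGap.TwoLattice.ConstTube

open Summit.QuantumFields.YangMills.Theorems.FemtoTransferGap
open Summit.QuantumFields.YangMills.Theorems.FemtoTransferGap.TwoLattice
open Summit.QuantumFields.YangMills.Theorems.FemtoTransferGap.TwoLattice.Avg
open Summit.QuantumFields.YangMills.Theorems.FemtoTransferGap.TwoLattice.Stiff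
open Summit.QuantumFields.YangMills.Theorems.FemtoTransferGap.TwoLattice.Cov

/-! ## §1 Spectral quadratic forms are invariant under commuting isometries -/

/-- ★ For a symmetric `T` with eigenframe `(eᵢ, aᵢ)`, any `g : ℝ → ℝ` and a linear isometry `R` commuting with `T`: `Σᵢ g(aᵢ)⟪eᵢ,Rx⟫² = Σᵢ g(aᵢ)⟪eᵢ,x⟫²`.
(Interpolate `g` on the spectrum by a polynomial `p`; both sides are `⟪·, p(T)·⟫`, and `p(T)` commutes with `R`.) [folklore] -/
theorem sum_eigen_sq_isometry_invariant {E : Type*} [NormedAddCommGroup E] [InnerProductSpace ℝ E] [FiniteDimensional ℝ E] {n : ℕ} {T : E →ₗ[ℝ] E}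
    (hT : T.IsSymmetric) (hn : Module.finrank ℝ E = n) (g : ℝ → ℝ) (R : E ≃ₗᵢ[ℝ] E) (hR : ∀ v, T (R v) = R (T v)) (x : E) :
    ∑ i, g (hT.eigenvalues hn i) * ⟪hT.eigenvectorBasis hn i, R x⟫ ^ 2 = ∑ i, g (hT.eigenvalues hn i) * ⟪hT.eigenvectorBasis hn i, x⟫ ^ 2 := by
  classical
  set e := hT.eigenvectorBasis hn with he
  set a := hT.eigenvalues hn with ha
  -- a polynomial agreeing with `g` on the spectrum
  set s : Finset ℝ := Finset.univ.image a with hs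
  set p : ℝ[X] := Lagrange.interpolate s id g with hpdef
  have hp : ∀ i, p.eval (a i) = g (a i) := fun i => by
    have h := Lagrange.eval_interpolate_at_node (s := s) (v := id) g (Set.injOn_id _) (Finset.mem_image_of_mem a (Finset.mem_univ i))
    rw [id_eq] at h
    rw [hpdef]; exact h
  have hA : ∀ i, aeval T p (e i) = p.eval (a i) • e i := fun i => by
    have h := Module.End.aeval_apply_of_hasEigenvector (p := p) (hT.hasEigenvector_eigenvectorBasis hn i)
    simpa using h
  -- both sides are `⟪y, p(T) y⟫`
  have key : ∀ y : E, ∑ i, g (a i) * ⟪e i, y⟫ ^ 2 = ⟪y, aeval T p y⟫ := by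
    intro y
    have hAy : aeval T p y = ∑ i, (⟪e i, y⟫ * p.eval (a i)) • e i := by
      conv_lhs => rw [← e.sum_repr' y]
      rw [map_sum]
      refine Finset.sum_congr rfl fun i _ => ?_
      rw [map_smul, hA i, smul_smul]
    rw [hAy, inner_sum]
    refine Finset.sum_congr rfl fun i _ => ?_
    rw [real_inner_smul_right, real_inner_comm (e i) y, hp i]
    ring
  -- `p(T)` commutes with `R`
  have hcomm : ∀ (q : ℝ[X]) (v : E), aeval T q (R v) = R (aeval T q v) := by
    intro q
    induction q using Polynomial.induction_on' with
    | add p₁ p₂ h₁ h₂ => intro v; rw [map_add, LinearMap.add_apply, LinearMap.add_apply, h₁, h₂, map_add]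
    | monomial k c =>
        intro v
        induction k generalizing v with
        | zero => simp [Module.algebraMap_end_apply]
        | succ k ih =>
            have e1 : ∀ w : E, aeval T (monomial (k + 1) c) w = aeval T (monomial k c) (T w) := fun w => by
              rw [show monomial (k + 1) c = monomial k c * X by rw [Polynomial.monomial_mul_X], map_mul, Module.End.mul_apply, aeval_X]
            rw [e1, e1, hR, ih]
  rw [key, key, hcomm, LinearIsometryEquiv.inner_map_map]

/-! ## §2 Colour equivariance of the lattice curl and the stiff Hessian -/

variable {L : ℕ} [NeZero L]

/-- The curl acts colour by colour: `(d(Ad_g v))(p;·) = Ad_g (dv)(p;·)`. [folklore] -/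
theorem latCurl_adL (g : SU2) (v : LinkSpace L) (x : Site 3 L) (ij : {p : Fin 3 × Fin 3 // p.1 < p.2}) (a : Fin 3) :
    latCurl L (adL L g v) ((x, ij), a) = ((adRot g).mulVec fun b => latCurl L v ((x, ij), b)) a := by
  rw [latCurl_apply]
  simp only [adL_apply, adLin_apply, latCurl_apply]
  simp only [Matrix.mulVec, dotProduct, mul_add, mul_sub, Finset.sum_add_distrib, Finset.sum_sub_distrib]

/-- `‖d(Ad_g v)‖ = ‖dv‖`. [folklore] -/
theorem norm_latCurl_adL (g : SU2) (v : LinkSpace L) : ‖latCurl L (adL L g v)‖ = ‖latCurl L v‖ := by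
  have h : ‖latCurl L (adL L g v)‖ ^ 2 = ‖latCurl L v‖ ^ 2 := by
    have e1 : ∑ q : Plaquette 3 L × Fin 3, (latCurl L (adL L g v) q) ^ 2 = ∑ p : Plaquette 3 L, ∑ a : Fin 3, (latCurl L (adL L g v) (p, a)) ^ 2 :=
      Fintype.sum_prod_type _
    have e2 : ∑ q : Plaquette 3 L × Fin 3, (latCurl L v q) ^ 2 = ∑ p : Plaquette 3 L, ∑ a : Fin 3, (latCurl L v (p, a)) ^ 2 := Fintype.sum_prod_type _
    rw [norm_latCurl_sq, norm_latCurl_sq, e1, e2]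
    refine Finset.sum_congr rfl fun p _ => ?_
    obtain ⟨x, ij⟩ := p
    have e : ∀ a, latCurl L (adL L g v) ((x, ij), a) = ((adRot g).mulVec fun b => latCurl L v ((x, ij), b)) a := fun a => latCurl_adL g v x ij a
    simp_rw [e]
    exact sum_sq_adRot_mulVec g _
  have h1 := norm_nonneg (latCurl L (adL L g v))
  have h2 := norm_nonneg (latCurl L v)
  nlinarith [h, h1, h2, sq_nonneg (‖latCurl L (adL L g v)‖ - ‖latCurl L v‖)]

/-- `⟪d(Ad_g v), d(Ad_g w)⟫ = ⟪dv, dw⟫` (polarisation). [folklore] -/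
theorem inner_latCurl_adL (g : SU2) (v w : LinkSpace L) : ⟪latCurl L (adL L g v), latCurl L (adL L g w)⟫ = ⟪latCurl L v, latCurl L w⟫ := by
  rw [real_inner_eq_norm_add_mul_self_sub_norm_mul_self_sub_norm_mul_self_div_two,
    real_inner_eq_norm_add_mul_self_sub_norm_mul_self_sub_norm_mul_self_div_two, ← map_add, ← map_add, norm_latCurl_adL, norm_latCurl_adL, norm_latCurl_adL,
    ← map_add]

/-- `⟪Ad_g v, H(Ad_g w)⟫ = ⟪v, Hw⟫`. [folklore] -/
theorem inner_stiffHessian_adL (g : SU2) (v w : LinkSpace L) : ⟪adL L g v, stiffHessian L (adL L g w)⟫ = ⟪v, stiffHessian L w⟫ := by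
  unfold stiffHessian
  rw [LinearMap.comp_apply, LinearMap.comp_apply, LinearMap.adjoint_inner_right, LinearMap.adjoint_inner_right, inner_latCurl_adL]

/-- ★ **The stiff Hessian is colour blind**: `H(Ad_g x) = Ad_g(Hx)`. [folklore] -/
theorem stiffHessian_adL (g : SU2) (w : LinkSpace L) : stiffHessian L (adL L g w) = adL L g (stiffHessian L w) := by
  refine ext_inner_left ℝ fun u => ?_
  have h1 : ⟪u, stiffHessian L (adL L g w)⟫ = ⟪(adL L g).symm u, stiffHessian L w⟫ := by
    conv_lhs => rw [← (adL L g).apply_symm_apply u]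
    exact inner_stiffHessian_adL g _ w
  rw [h1, ← (adL L g).inner_map_map ((adL L g).symm u) (stiffHessian L w), LinearIsometryEquiv.apply_symm_apply]

/-! ## §3 The frozen stiff Gaussian exponent -/

/-- `t·H` is symmetric (any real `t`). [folklore] -/
theorem isSymmetric_smul_stiffHessian (t : ℝ) : (t • stiffHessian L).IsSymmetric := (stiffHessian_isSymmetric L).smul (by simp)

variable (L) in
/-- **The frozen stiff Gaussian exponent** `q_{t,b}(x) = Σᵢ √(aᵢ² + 2aᵢb)·⟪eᵢ,x⟫²`, `(eᵢ,aᵢ)` the eigenframe of `t·H` (`H = d†d` the stiff Hessian): for `t ≥ 0`, `b > 0`,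
`e^{−q}` is the ground state of the harmonic stiff transfer kernel `e^{−⟪x,tHx⟫}e^{−b‖x−y‖²}e^{−⟪y,tHy⟫}` (`Stiff.stiff_groundState`). [cite: Wipf2021, §8.5.2 (8.64)–(8.67)] -/
def stiffGaussExp (t b : ℝ) (x : LinkSpace L) : ℝ :=
  ∑ i, Real.sqrt ((isSymmetric_smul_stiffHessian (L := L) t).eigenvalues finrank_euclideanSpace i ^ 2 +
      2 * (isSymmetric_smul_stiffHessian (L := L) t).eigenvalues finrank_euclideanSpace i * b) *
    ⟪(isSymmetric_smul_stiffHessian (L := L) t).eigenvectorBasis finrank_euclideanSpace i, x⟫ ^ 2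

/-- `0 ≤ q_{t,b}`. [folklore] -/
theorem stiffGaussExp_nonneg (t b : ℝ) (x : LinkSpace L) : 0 ≤ stiffGaussExp L t b x := by
  unfold stiffGaussExp
  exact Finset.sum_nonneg fun i _ => mul_nonneg (Real.sqrt_nonneg _) (sq_nonneg _)

/-- `q_{t,b}` is continuous. [folklore] -/
theorem continuous_stiffGaussExp (t b : ℝ) : Continuous (stiffGaussExp L t b) := by
  unfold stiffGaussExp
  refine continuous_finsetSum _ fun i _ => continuous_const.mul ((continuous_const.inner continuous_id).pow 2)

/-- `q_{t,b}` is measurable. [folklore] -/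
theorem measurable_stiffGaussExp (t b : ℝ) : Measurable (stiffGaussExp L t b) := (continuous_stiffGaussExp t b).measurable

/-- ★ **`q_{t,b}` is colour blind**: `q(Ad_g x) = q(x)`. [folklore] -/
theorem stiffGaussExp_adL (t b : ℝ) (g : SU2) (x : LinkSpace L) : stiffGaussExp L t b (adL L g x) = stiffGaussExp L t b x := by
  unfold stiffGaussExp
  exact sum_eigen_sq_isometry_invariant (isSymmetric_smul_stiffHessian (L := L) t) finrank_euclideanSpace (fun a => Real.sqrt (a ^ 2 + 2 * a * b)) (adL L g)
    (fun v => by rw [LinearMap.smul_apply, LinearMap.smul_apply, stiffHessian_adL, map_smul]) x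

/-! ## §4 ★★★ The record analytic input from (B-ST) + (B-OD) against the frozen stiff Gaussian profile -/

/-- ★★★ **`RecordAnalyticInput L s M` FROM (B-ST) AND (B-OD) AGAINST THE FROZEN STIFF GAUSSIAN PROFILE** `Ω_β = frozenProfile L (β ↦ q_{t(β),b(β)}) r_B β`
(`r_B = min(1/40, β^{-1/2}ℓ)`, any schedules `t, b : ℝ → ℝ`; `1/6 < s ≤ 1/4`). [cite: Luscher1983, §3] [cite: SjostrandZworski2007, §2] -/
theorem recordAnalyticInput_of_stiffGauss {s M : ℝ} (hs6 : 1 / 6 < s) (hs4 : s ≤ 1 / 4) (t b : ℝ → ℝ)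
    {bOD : ℝ → ℝ} {θ₀ : ℝ} (hb : ∀ β, 0 ≤ bOD β) (hb_small : ∀ a : ℝ, 0 < a → ∀ᶠ β in atTop, bOD β ^ 2 ≤ a * bareLambda ((L : ℝ) ^ 3 * β)) (hθ₀ : 0 < θ₀ ∧ θ₀ ≤ 1)
    (hST : ∀ᶠ β in atTop, ∀ v : GaugeConfig 3 L SU2 → ℝ, Measurable v → (∃ C : ℝ, ∀ U, |v U| ≤ C) → (∀ U, v U ≠ 0 → recordChi L s 43 M β U ≠ 0) →
      (∀ u, fibreInner L (softWeight (recordChi L s 43 M β))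
        (frozenProfile L (fun β => stiffGaussExp L (t β) (b β)) (fun β => min (1 / 40) (powScale (1 / 2) β * btLog β)) β) v u = 0) →
      tubeForm β v ≤ (1 - θ₀) *
        ((btC L β (frozenProfile L (fun β => stiffGaussExp L (t β) (b β)) (fun β => min (1 / 40) (powScale (1 / 2) β * btLog β)) β) (btEps β)
              (5 * (powScale (1 / 2) β * btLog β ^ 2)) / fpZ (btEps β) /
            recordGamma L (frozenProfile L (fun β => stiffGaussExp L (t β) (b β)) (fun β => min (1 / 40) (powScale (1 / 2) β * btLog β))) β) *
          levelValue su2Rep 1 ((L : ℝ) ^ 3 * β) 0) * tubeNormSq (softWeight (recordChi L s 43 M β)) v)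
    (hOD : ∀ᶠ β in atTop, ∀ (φ : GaugeConfig 3 1 SU2 → ℝ) (v : GaugeConfig 3 L SU2 → ℝ), Measurable φ → (∃ C : ℝ, ∀ u, |φ u| ≤ C) →
      (∀ u, φ u ≠ 0 → orbitDist u < recordDelta1 L s β) → Measurable v → (∃ C : ℝ, ∀ U, |v U| ≤ C) → (∀ U, v U ≠ 0 → recordChi L s 43 M β U ≠ 0) →
      (∀ u, fibreInner L (softWeight (recordChi L s 43 M β))
        (frozenProfile L (fun β => stiffGaussExp L (t β) (b β)) (fun β => min (1 / 40) (powScale (1 / 2) β * btLog β)) β) v u = 0) →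
      |tubeCross β (boFun L φ (frozenProfile L (fun β => stiffGaussExp L (t β) (b β)) (fun β => min (1 / 40) (powScale (1 / 2) β * btLog β)) β)) v| ≤
          bOD β * ((btC L β (frozenProfile L (fun β => stiffGaussExp L (t β) (b β)) (fun β => min (1 / 40) (powScale (1 / 2) β * btLog β)) β) (btEps β)
                (5 * (powScale (1 / 2) β * btLog β ^ 2)) / fpZ (btEps β) /
              recordGamma L (frozenProfile L (fun β => stiffGaussExp L (t β) (b β)) (fun β => min (1 / 40) (powScale (1 / 2) β * btLog β))) β) *
            levelValue su2Rep 1 ((L : ℝ) ^ 3 * β) 0) *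
          Real.sqrt (tubeNormSq (softWeight (recordChi L s 43 M β))
            (boFun L φ (frozenProfile L (fun β => stiffGaussExp L (t β) (b β)) (fun β => min (1 / 40) (powScale (1 / 2) β * btLog β)) β))) *
          Real.sqrt (tubeNormSq (softWeight (recordChi L s 43 M β)) v) ∧
      |tubeCross β v (boFun L φ (frozenProfile L (fun β => stiffGaussExp L (t β) (b β)) (fun β => min (1 / 40) (powScale (1 / 2) β * btLog β)) β))| ≤
          bOD β * ((btC L β (frozenProfile L (fun β => stiffGaussExp L (t β) (b β)) (fun β => min (1 / 40) (powScale (1 / 2) β * btLog β)) β) (btEps β)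
                (5 * (powScale (1 / 2) β * btLog β ^ 2)) / fpZ (btEps β) /
              recordGamma L (frozenProfile L (fun β => stiffGaussExp L (t β) (b β)) (fun β => min (1 / 40) (powScale (1 / 2) β * btLog β))) β) *
            levelValue su2Rep 1 ((L : ℝ) ^ 3 * β) 0) *
          Real.sqrt (tubeNormSq (softWeight (recordChi L s 43 M β))
            (boFun L φ (frozenProfile L (fun β => stiffGaussExp L (t β) (b β)) (fun β => min (1 / 40) (powScale (1 / 2) β * btLog β)) β))) *
          Real.sqrt (tubeNormSq (softWeight (recordChi L s 43 M β)) v)) :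
    Nonempty (RecordAnalyticInput L s M) :=
  recordAnalyticInput_of_frozenProfile (q := fun β => stiffGaussExp L (t β) (b β)) hs6 hs4 (fun β => measurable_stiffGaussExp (t β) (b β))
    (fun β x => stiffGaussExp_nonneg (t β) (b β) x) (fun β g x => stiffGaussExp_adL (t β) (b β) g x) hb hb_small hθ₀ hST hOD

/-! ## §5 The ground-state identity, restated for `e^{−q_{t,b}}` -/

/-- ★ **`e^{−q_{t,b}}` IS the stiff Gaussian ground state**: for `t ≥ 0`, `b > 0` the harmonic stiff transfer kernel reproduces `e^{−stiffGaussExp L t b}` with the factor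
`Πᵢ √(π/(aᵢ + b + √(aᵢ²+2aᵢb)))` (`Stiff.stiff_groundState` with `cᵢ = √(aᵢ² + 2aᵢb)`). [cite: Wipf2021, §8.5.2 (8.64)–(8.67)] -/
theorem stiff_groundState_stiffGaussExp {t : ℝ} (ht : 0 ≤ t) {b : ℝ} (hb : 0 < b) (x : LinkSpace L) :
    ∫ y, Real.exp (-⟪x, (t • stiffHessian L) x⟫) * Real.exp (-(b * ‖x - y‖ ^ 2)) * Real.exp (-⟪y, (t • stiffHessian L) y⟫) * Real.exp (-stiffGaussExp L t b y) =
      (∏ i, Real.sqrt (π / ((isSymmetric_smul_stiffHessian (L := L) t).eigenvalues finrank_euclideanSpace i + b +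
          Real.sqrt ((isSymmetric_smul_stiffHessian (L := L) t).eigenvalues finrank_euclideanSpace i ^ 2 +
            2 * (isSymmetric_smul_stiffHessian (L := L) t).eigenvalues finrank_euclideanSpace i * b)))) *
        Real.exp (-stiffGaussExp L t b x) := by
  have ha : ∀ i, 0 ≤ (isSymmetric_smul_stiffHessian (L := L) t).eigenvalues finrank_euclideanSpace i :=
    (isPositive_smul_stiffHessian L ht).nonneg_eigenvalues finrank_euclideanSpace
  have hc0 : ∀ i, 0 ≤ Real.sqrt ((isSymmetric_smul_stiffHessian (L := L) t).eigenvalues finrank_euclideanSpace i ^ 2 +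
      2 * (isSymmetric_smul_stiffHessian (L := L) t).eigenvalues finrank_euclideanSpace i * b) := fun i => Real.sqrt_nonneg _
  have hc : ∀ i, Real.sqrt ((isSymmetric_smul_stiffHessian (L := L) t).eigenvalues finrank_euclideanSpace i ^ 2 +
      2 * (isSymmetric_smul_stiffHessian (L := L) t).eigenvalues finrank_euclideanSpace i * b) ^ 2 =
      (isPositive_smul_stiffHessian L ht).isSymmetric.eigenvalues finrank_euclideanSpace i ^ 2 +
        2 * (isPositive_smul_stiffHessian L ht).isSymmetric.eigenvalues finrank_euclideanSpace i * b := fun i =>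
    Real.sq_sqrt (by have := ha i; positivity)
  exact stiff_groundState L ht finrank_euclideanSpace hb hc0 hc x

end Summit.QuantumFields.YangMills.Theorems.FemtoTransferGap.TwoLattice.ConstTube

end
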